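import Mathlib
import HarnessLib
import Literature.NumberTheory.LFunctions.ZetaScrew
import Summits.RiemannHypothesis.RiemannHypothesis.Theorems.IntegerScrewIncrementGram

/-!
# Route `IntegerScrew` — the abstract Gram CEILING lemma: no predictor in a «rows + diagonals + bounded
# cross terms» family gains more than `Σ_i C_i²/w_i + ε` (PIVOT-LAW §15.9/§15.16; companion of
# `IntegerScrewIncrementGram.eventually_gramFloor`)

Setting of `eventually_gramFloor`: a finite index set `s` with a distinguished `i₀`, scaled Gram entries
`g_M(i,j)` (symmetric on `s`), `L_M → ∞`, rows `g_M(i₀,i) → C_i`, diagonals `g_M(i,i)/L_M → w_i > 0`, cross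
terms `g_M(i,j)` (`i ≠ j`, both `≠ i₀`) eventually bounded.  There the coefficients `θ_i = −(C_i/w_i)/L_M` GAIN
`Σ_{i ≠ i₀} C_i²/w_i − ε` (times `1/L_M`).  Here the converse:

* `finsetSum_mul_ge_diag_sub_offdiag` — Gershgorin: `Σ_{i,j ∈ t} u_i u_j Γ(i,j) ≥ Σ_i (Γ(i,i) − R_i)u_i²`,
  `R_i = Σ_{j ≠ i} |Γ(i,j)|`, for a kernel symmetric on `t`;
* `sum_sum_insert_expand` — `Σ_{i,j ∈ insert i₀ t} θ_iθ_j g(i,j)` peeled at `i₀` (`θ_{i₀} = 1`);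
* **`eventually_gramCeiling`** — for every `ε > 0`, eventually in `M`, for ALL coefficient vectors `θ` with
  `θ_{i₀} = 1`: `(g_M(i₀,i₀) − Σ_{i,j ∈ s} θ_iθ_j g_M(i,j))·L_M ≤ Σ_{i ∈ s∖{i₀}} C_i²/w_i + ε` — uniformly in `θ`
  (Gershgorin makes the `s∖{i₀}` block `⪰ diag(d_i)` with `d_i/L_M → w_i`; completing the square direction by
  direction bounds the gain by `Σ g_M(i₀,i)²/d_i`).

With the floor lemma: the best gain of the family is EXACTLY `(Σ_{i≠i₀} C_i²/w_i)/L_M·(1 + o(1))`.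
`IntegerScrewArithmeticSharp` instantiates this for the neighbours + hinge carriers.  Pure elementary
analysis; nothing here bears on the truth of RH. [Suzuki2023, (1.4)]
-/

noncomputable section

-- D-0017: `Summit.<S>.<S>.…` is the designed namespace of a single-problem summit.
set_option linter.dupNamespace false

namespace Summit.RiemannHypothesis.RiemannHypothesis.Theorems.IntegerScrew

open Literature.NumberTheory.LFunctions Finset Filter
open scoped Topology

/-! ### Gershgorin over a finite index set -/

/-- **GERSHGORIN-TYPE LOWER BOUND** over a finite index set `t`: for `Γ` symmetric on `t`,
`Σ_{i ∈ t} (Γ(i,i) − Σ_{j ∈ t, j ≠ i} |Γ(i,j)|)·u_i² ≤ Σ_{i,j ∈ t} u_i u_j Γ(i,j)`. [folklore] -/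
theorem finsetSum_mul_ge_diag_sub_offdiag {ι : Type*} [DecidableEq ι] (t : Finset ι) (u : ι → ℝ)
    (Γ : ι → ι → ℝ) (hsym : ∀ i ∈ t, ∀ j ∈ t, Γ i j = Γ j i) :
    ∑ i ∈ t, (Γ i i - ∑ j ∈ t, (if j = i then 0 else |Γ i j|)) * u i ^ 2
      ≤ ∑ i ∈ t, ∑ j ∈ t, u i * u j * Γ i j := by
  -- termwise bound
  have hterm : ∀ i j : ι, (if j = i then Γ i i * u i ^ 2 else 0)
      - (if j = i then 0 else |Γ i j|) * (u i ^ 2 + u j ^ 2) / 2 ≤ u i * u j * Γ i j := by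
    intro i j
    by_cases hji : j = i
    · subst hji
      rw [if_pos rfl, if_pos rfl, zero_mul, zero_div, sub_zero]
      exact le_of_eq (by ring)
    · simp only [hji, if_false, zero_sub]
      have h2 : 2 * (|u i| * |u j|) ≤ u i ^ 2 + u j ^ 2 := by
        have := two_mul_le_add_sq (|u i|) (|u j|)
        simp only [sq_abs] at this; linarith
      have h3 : -(|Γ i j| * (|u i| * |u j|)) ≤ u i * u j * Γ i j := by
        have : |u i * u j * Γ i j| = |Γ i j| * (|u i| * |u j|) := by
          rw [abs_mul, abs_mul]; ring
        rw [← this]; exact neg_abs_le _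
      have h4 : |Γ i j| * (|u i| * |u j|) ≤ |Γ i j| * (u i ^ 2 + u j ^ 2) / 2 := by
        have := mul_le_mul_of_nonneg_left h2 (abs_nonneg (Γ i j)); linarith
      linarith
  have hsum := Finset.sum_le_sum fun i (_ : i ∈ t) =>
    Finset.sum_le_sum fun j (_ : j ∈ t) => hterm i j
  refine le_trans (le_of_eq ?_) hsum
  -- evaluate the bound row by row
  have hrow : ∀ i ∈ t, ∑ j ∈ t, ((if j = i then Γ i i * u i ^ 2 else 0)
      - (if j = i then 0 else |Γ i j|) * (u i ^ 2 + u j ^ 2) / 2)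
      = Γ i i * u i ^ 2 - ∑ j ∈ t, (if j = i then 0 else |Γ i j|) * u i ^ 2 / 2
        - ∑ j ∈ t, (if j = i then 0 else |Γ i j|) * u j ^ 2 / 2 := by
    intro i hi
    rw [Finset.sum_sub_distrib, Finset.sum_ite_eq' t i, if_pos hi, sub_sub, ← Finset.sum_add_distrib]
    congr 1
    exact Finset.sum_congr rfl fun j _ => by ring
  rw [Finset.sum_congr rfl hrow, Finset.sum_sub_distrib, Finset.sum_sub_distrib]
  -- symmetrise the last double sum
  have hoff2 : ∑ i ∈ t, ∑ j ∈ t, (if j = i then (0 : ℝ) else |Γ i j|) * u j ^ 2 / 2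
      = ∑ i ∈ t, ∑ j ∈ t, (if j = i then (0 : ℝ) else |Γ i j|) * u i ^ 2 / 2 := by
    rw [Finset.sum_comm]
    refine Finset.sum_congr rfl fun i hi => Finset.sum_congr rfl fun j hj => ?_
    by_cases h : i = j
    · subst h; simp
    · rw [if_neg h, if_neg (Ne.symm h), hsym j hj i hi]
  rw [hoff2, ← Finset.sum_sub_distrib, ← Finset.sum_sub_distrib]
  refine Finset.sum_congr rfl fun i _ => ?_
  rw [sub_mul, Finset.sum_mul, sub_sub, ← Finset.sum_add_distrib]
  congr 1
  exact Finset.sum_congr rfl fun j _ => by ring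

/-! ### Peeling the distinguished index -/

/-- Expansion of the Gram form over `insert i₀ t` (`i₀ ∉ t`, `θ_{i₀} = 1`, `g` symmetric):
`Σ_{i,j} θ_iθ_j g(i,j) = g(i₀,i₀) + 2Σ_{i ∈ t} θ_i g(i₀,i) + Σ_{i,j ∈ t} θ_iθ_j g(i,j)`. [folklore] -/
theorem sum_sum_insert_expand {ι : Type*} [DecidableEq ι] {t : Finset ι} {i₀ : ι} (hi₀ : i₀ ∉ t)
    (θ : ι → ℝ) (hθ : θ i₀ = 1) (g : ι → ι → ℝ) (hsym : ∀ i ∈ t, g i i₀ = g i₀ i) :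
    ∑ i ∈ insert i₀ t, ∑ j ∈ insert i₀ t, θ i * θ j * g i j
      = g i₀ i₀ + 2 * ∑ i ∈ t, θ i * g i₀ i + ∑ i ∈ t, ∑ j ∈ t, θ i * θ j * g i j := by
  rw [Finset.sum_insert hi₀, Finset.sum_insert hi₀,
    Finset.sum_congr rfl fun i _ => Finset.sum_insert hi₀, Finset.sum_add_distrib, hθ]
  have hc : ∑ i ∈ t, θ i * 1 * g i i₀ = ∑ i ∈ t, θ i * g i₀ i :=
    Finset.sum_congr rfl fun i hi => by rw [mul_one, hsym i hi]
  rw [hc]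
  have hr : ∑ j ∈ t, 1 * θ j * g i₀ j = ∑ i ∈ t, θ i * g i₀ i :=
    Finset.sum_congr rfl fun j _ => by rw [one_mul]
  rw [hr]
  ring

/-! ### The ceiling lemma -/

/-- **GRAM CEILING LEMMA.**  In the setting of `eventually_gramFloor` (rows `g_M(i₀,i) → C_i`, diagonals
`g_M(i,i)/L_M → w_i > 0`, cross terms eventually bounded, `L_M → ∞`, `g_M` symmetric on `s`): for every
`ε > 0`, eventually in `M`, for ALL `θ` with `θ_{i₀} = 1`,
`(g_M(i₀,i₀) − Σ_{i,j ∈ s} θ_iθ_j g_M(i,j))·L_M ≤ Σ_{i ∈ s∖{i₀}} C_i²/w_i + ε`. [folklore] -/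
theorem eventually_gramCeiling {ι : Type*} [DecidableEq ι] (s : Finset ι) {i₀ : ι} (hi₀ : i₀ ∈ s)
    (g : ℕ → ι → ι → ℝ) (L : ℕ → ℝ) (C w : ι → ℝ)
    (hL : Tendsto L atTop atTop)
    (hsymm : ∀ M, ∀ i ∈ s, ∀ j ∈ s, g M i j = g M j i)
    (hrow : ∀ i ∈ s, i ≠ i₀ → Tendsto (fun M => g M i₀ i) atTop (𝓝 (C i)))
    (hdiag : ∀ i ∈ s, i ≠ i₀ → Tendsto (fun M => g M i i / L M) atTop (𝓝 (w i)))
    (hw : ∀ i ∈ s, i ≠ i₀ → 0 < w i)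
    (hoff : ∀ i ∈ s, ∀ j ∈ s, i ≠ i₀ → j ≠ i₀ → i ≠ j → ∃ B : ℝ, ∀ᶠ M in atTop, |g M i j| ≤ B)
    {ε : ℝ} (hε : 0 < ε) :
    ∀ᶠ M in atTop, ∀ θ : ι → ℝ, θ i₀ = 1 →
      (g M i₀ i₀ - ∑ i ∈ s, ∑ j ∈ s, θ i * θ j * g M i j) * L M
        ≤ (∑ i ∈ s.erase i₀, C i ^ 2 / w i) + ε := by
  set s' := s.erase i₀ with hs'
  have hs : s = insert i₀ s' := by rw [hs', Finset.insert_erase hi₀]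
  have hi₀' : i₀ ∉ s' := Finset.notMem_erase i₀ s
  have hmem' : ∀ i ∈ s', i ∈ s ∧ i ≠ i₀ := fun i hi =>
    ⟨Finset.mem_of_mem_erase hi, Finset.ne_of_mem_erase hi⟩
  -- the Gershgorin radius R_i(M) := Σ_{j ∈ s', j ≠ i} |g_M(i,j)| is eventually bounded, so R_i/L → 0
  set R : ℕ → ι → ℝ := fun M i => ∑ j ∈ s', (if j = i then 0 else |g M i j|) with hR
  have hRlim : ∀ i ∈ s', Tendsto (fun M => R M i / L M) atTop (𝓝 0) := by
    intro i hi
    simp only [hR, Finset.sum_div]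
    rw [show (0 : ℝ) = ∑ j ∈ s', (0 : ℝ) by simp]
    refine tendsto_finsetSum s' fun j hj => ?_
    by_cases hji : j = i
    · simp [hji]
    · simp only [hji, if_false]
      obtain ⟨B, hB⟩ := hoff i (hmem' i hi).1 j (hmem' j hj).1 (hmem' i hi).2 (hmem' j hj).2
        (Ne.symm hji)
      have hLinv : Tendsto (fun M => (L M)⁻¹) atTop (𝓝 0) := hL.inv_tendsto_atTop
      have hbound : ∀ᶠ M in atTop, ‖|g M i j| / L M‖ ≤ B * |(L M)⁻¹| := by
        filter_upwards [hB] with M hM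
        rw [Real.norm_eq_abs, div_eq_mul_inv, abs_mul, abs_abs]
        gcongr
      refine squeeze_zero_norm' hbound ?_
      have : Tendsto (fun M => B * |(L M)⁻¹|) atTop (𝓝 (B * |0|)) :=
        ((continuous_abs.tendsto 0).comp hLinv).const_mul B
      simpa using this
  -- d_i/L := (g_ii − R_i)/L → w_i, hence the per-direction bound g_{0i}²·L/d_i → C_i²/w_i
  have hdlim : ∀ i ∈ s', Tendsto (fun M => (g M i i - R M i) / L M) atTop (𝓝 (w i)) := by
    intro i hi
    have := (hdiag i (hmem' i hi).1 (hmem' i hi).2).sub (hRlim i hi)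
    rw [sub_zero] at this
    exact this.congr fun M => by ring
  have hterm : ∀ i ∈ s', Tendsto (fun M => (g M i₀ i) ^ 2 / ((g M i i - R M i) / L M)) atTop
      (𝓝 (C i ^ 2 / w i)) := fun i hi =>
    ((hrow i (hmem' i hi).1 (hmem' i hi).2).pow 2).div (hdlim i hi)
      (hw i (hmem' i hi).1 (hmem' i hi).2).ne'
  have hsumlim : Tendsto (fun M => ∑ i ∈ s', (g M i₀ i) ^ 2 / ((g M i i - R M i) / L M)) atTop
      (𝓝 (∑ i ∈ s', C i ^ 2 / w i)) := tendsto_finsetSum s' hterm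
  have hev1 := hsumlim.eventually (Iio_mem_nhds (show ∑ i ∈ s', C i ^ 2 / w i
    < (∑ i ∈ s', C i ^ 2 / w i) + ε by linarith))
  -- eventually every d_i > 0 and L > 0
  have hev2 : ∀ᶠ M in atTop, ∀ i ∈ s', 0 < (g M i i - R M i) / L M :=
    (eventually_all_finset s').2 fun i hi =>
      (hdlim i hi).eventually (Ioi_mem_nhds (hw i (hmem' i hi).1 (hmem' i hi).2))
  have hLpos : ∀ᶠ M in atTop, 0 < L M := hL.eventually (eventually_gt_atTop 0)
  filter_upwards [hev1, hev2, hLpos] with M hM1 hM2 hLM θ hθ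
  have hd : ∀ i ∈ s', 0 < g M i i - R M i := by
    intro i hi
    have := hM2 i hi
    rwa [div_pos_iff_of_pos_right hLM] at this
  -- expand the form and apply Gershgorin on s'
  rw [hs, sum_sum_insert_expand hi₀' θ hθ (g M) (fun i hi => hsymm M i (hmem' i hi).1 i₀ hi₀)]
  have hG := finsetSum_mul_ge_diag_sub_offdiag s' θ (g M)
    (fun i hi j hj => hsymm M i (hmem' i hi).1 j (hmem' j hj).1)
  -- (g₀₀ − Q)·L ≤ −(2Σθ g₀ + Σ d θ²)·L ≤ Σ g₀²/d · L
  have hstep : (g M i₀ i₀ - (g M i₀ i₀ + 2 * ∑ i ∈ s', θ i * g M i₀ i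
        + ∑ i ∈ s', ∑ j ∈ s', θ i * θ j * g M i j)) * L M
      ≤ (∑ i ∈ s', (g M i₀ i) ^ 2 / (g M i i - R M i)) * L M := by
    refine mul_le_mul_of_nonneg_right ?_ hLM.le
    have h1 : -(2 * ∑ i ∈ s', θ i * g M i₀ i) - ∑ i ∈ s', (g M i i - R M i) * θ i ^ 2
        ≤ ∑ i ∈ s', (g M i₀ i) ^ 2 / (g M i i - R M i) := by
      rw [Finset.mul_sum, ← Finset.sum_neg_distrib, ← Finset.sum_sub_distrib]
      refine Finset.sum_le_sum fun i hi => ?_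
      have hdi := hd i hi
      rw [le_div_iff₀ hdi]
      nlinarith [sq_nonneg (g M i₀ i + (g M i i - R M i) * θ i)]
    have hG' : ∑ i ∈ s', (g M i i - R M i) * θ i ^ 2 ≤ ∑ i ∈ s', ∑ j ∈ s', θ i * θ j * g M i j := by
      simpa only [hR] using hG
    linarith
  refine hstep.trans ?_
  rw [Finset.sum_mul]
  have e : ∑ i ∈ s', (g M i₀ i) ^ 2 / (g M i i - R M i) * L M
      = ∑ i ∈ s', (g M i₀ i) ^ 2 / ((g M i i - R M i) / L M) := by
    refine Finset.sum_congr rfl fun i hi => ?_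
    have := (hd i hi).ne'
    field_simp
  rw [e]
  exact hM1.le

end Summit.RiemannHypothesis.RiemannHypothesis.Theorems.IntegerScrew

end
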